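import Literature.NumberTheory.Transcendental.PadicCW77Main
import Literature.NumberTheory.Transcendental.PadicCW77Reduction
import HarnessLib

/-!
# The `p`-adic Cijsouw–Waldschmidt bound: the top assembly

Support file (definitions and proved theorems; no named fact), sequel to `PadicCW77Main.lean` and
`PadicCW77Reduction.lean` (cell `abc-stewartyu`, WP-A5 top). It packages, for one set-up `S` with
target exponent `U`, the parameters of the descent together with the DISCHARGED inputs of the
machine `PadicCW77.Setup.main` — `ParamPack S U` (the sizes and the purely combinatorial inputs
unconditionally, the two numerical inequalities `KFinal`, `HalfStep` under the smallness hypothesis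
`‖Λ₀‖_p ≤ e^{−U}`, and `log p ≤ U`) — and proves:

* `norm_Λ₀_gt_of_paramPack` — a `ParamPack S U` gives `e^{−U} < ‖Λ₀‖_p`;
* `coreBound_of_paramPack` — a `ParamPack` for every set-up with Kummer-free independent generators
  and sizes `V, V_θ ≤ V_max`, `W`, at `U = C(d+1) (∏V·V_θ)(W + log 2V_max) log(2V_max)/(log p)^{r(d+1)}`,
  gives `CoreBound C r`;
* `ParamPack.mono` — packs are monotone in the exponent (`U ≤ U'`);
* `theoremA_of_coreBound` / `theoremAShapeLe_of_coreBound` — with `2 ≤ C m`,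
  `2 C m ≤ c₁^m m^{c₂ m}` (`m ≥ 1`), `r m ≤ m`, `1 ≤ c₁`, `0 ≤ c₂ ≤ κ`: the cell's `TheoremA`
  (verbatim shape `TheoremAShape`, `κ = 10`; `TheoremAShapeLe κ` for any cap, `κ = 2` being the
  cell's `TheoremATwo`), constant `m ↦ if m = 0 then 1 else 2 C m`;
* `coreBound_of_paramPack_pos` — packs are only needed for `d ≥ 1` (`d = 0` by Liouville);
* `theoremAShapeLe_of_packs` — THE CLOSING ADAPTER: a pack for every set-up with `d ≥ 1` at SOME
  exponent `U ≤ Cw(d+1) (∏V·V_θ)(W + log 2V_max) log(2V_max)`, with `2 ≤ Cw m`,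
  `2 Cw m ≤ c₁^m m^{c₂ m}`, gives `TheoremAShapeLe κ` for every `κ ≥ c₂` (with `r = 0`);
* `kFinal_of_log_ineq` — the numerical inequality `KFinal` from two real inequalities in
  logarithmic form (the WP-A4 targets (K1), (K2)).

So the p-adic Theorem A is reduced to exhibiting `ParamPack`s (WP-A4: the parameter record and its
numerical inequalities; WP-A3: the half step). No sorry; the packs are hypotheses.

## References
* [Waldschmidt1980] M. Waldschmidt, Acta Arith. 37 (1980), Prop. 3.8 and §3.6 (pp. 263, 275).
* [Yu1990] K. Yu, *Linear forms in p-adic logarithms II*, Compositio Math. 74 (1990), Theorem 1.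
-/

noncomputable section

open NormedSpace Finset IsUltrametricDist Height
open scoped Nat

namespace Literature.NumberTheory.Transcendental

namespace PadicCW77

open CW77.Setup (Idx Tau tauNorm)

namespace Setup

variable (S : Setup)

/-- **A parameter pack for the set-up `S` at exponent `U`**: box parameters `h, Lb`, descent
parameters `J₀, L, L_θ, S₀, T, P, t`, size functions `Dmax, Mmax`, and the inputs of `main`:
`S₀` even, `1 ≤ t J`, `(d+1) t J ≤ ⌊T/2^J⌋`, `log p ≤ U`, the sizes `KSizes`, Siegel at level `0`,
the endgame at level `J₀`, and — under `‖Λ₀‖_p ≤ e^{−U}` — the numerical inequalities `KFinal` and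
the half steps. [cite: Waldschmidt1980, §§3.2–3.5 (pp. 264–274)] -/
structure ParamPack (U : ℝ) where
  /-- `h`: number of `Δ`-polynomials `Δ(X;r)`, `r < h` -/
  h : ℕ
  /-- `Lb`: range of the exponent of `Δ(X;h)` -/
  Lb : ℕ
  /-- the depth of the descent -/
  J₀ : ℕ
  /-- ranges of the free exponents -/
  L : Fin S.d → ℕ
  /-- range of the eliminated exponent -/
  Lθ : ℕ
  /-- number of points at level `0` -/
  S₀ : ℕ
  /-- number of derivatives at level `0` -/
  T : ℕ
  /-- the integer bound for the coefficients -/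
  P : ℤ
  /-- multiplicity of the inner steps at level `J` -/
  t : ℕ → ℕ
  /-- denominator bounds `Dmax J k` -/
  Dmax : ℕ → ℕ → ℝ
  /-- archimedean size bounds `Mmax J k` -/
  Mmax : ℕ → ℕ → ℝ
  /-- `S₀` is even -/
  hS₀ : Even S₀
  /-- `t J ≥ 1` -/
  ht : ∀ J, J < J₀ → 1 ≤ t J
  /-- room for the inner chain -/
  htT : ∀ J, J < J₀ → (S.d + 1) * t J ≤ T / 2 ^ J
  /-- `log p ≤ U` (so that `e^{−U} ≤ p⁻¹`) -/
  hUp : Real.log S.p ≤ U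
  /-- the archimedean sizes of the cores at every level -/
  hsz : ∀ J, J < J₀ → ∀ p : Idx S.d h Lb → ℤ, S.Inv J₀ L Lθ S₀ T P J p →
    S.KSizes J₀ J L Lθ S₀ T (t J) p (Dmax J) (Mmax J)
  /-- the numerical inequalities of the inner steps, from the smallness of `Λ₀` -/
  hfin : ‖S.Λ₀‖ ≤ Real.exp (-U) → ∀ J, J < J₀ → S.KFinal (h := h) (Lb := Lb) J S₀ (t J) (Dmax J) (Mmax J)
  /-- the half steps, from the smallness of `Λ₀` -/
  hhalf : ‖S.Λ₀‖ ≤ Real.exp (-U) → ∀ J, J < J₀ → S.HalfStep (h := h) (Lb := Lb) J₀ J L Lθ S₀ T (t J) P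
  /-- Siegel's lemma at level `0` -/
  hsiegel : S.Siegel (h := h) (Lb := Lb) J₀ L Lθ S₀ T P
  /-- the contradiction at level `J₀` -/
  hend : S.Endgame (h := h) (Lb := Lb) J₀ L Lθ S₀ T P

/-- **A parameter pack at exponent `U` gives `‖Λ₀‖_p > e^{−U}`.**
[cite: Waldschmidt1980, Prop. 3.8 (p. 263)] -/
theorem norm_Λ₀_gt_of_paramPack {U : ℝ} (pk : S.ParamPack U) : Real.exp (-U) < ‖S.Λ₀‖ := by
  by_contra hle
  push Not at hle
  have hp0 : (0 : ℝ) < S.p := by exact_mod_cast S.hp.pos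
  have hΛ : ‖S.Λ₀‖ ≤ (S.p : ℝ)⁻¹ := by
    refine hle.trans ?_
    rw [← Real.exp_log hp0, ← Real.exp_neg, Real.exp_le_exp]
    exact neg_le_neg pk.hUp
  exact S.main pk.hS₀ pk.ht pk.htT hΛ pk.hsz (pk.hfin hle) (pk.hhalf hle) pk.hsiegel pk.hend

/-- **Packs are monotone in the exponent**: a pack at `U` is a pack at every `U' ≥ U` (the
smallness hypothesis `‖Λ₀‖_p ≤ e^{−U'}` is stronger, `log p ≤ U ≤ U'`).
[cite: Waldschmidt1980, Prop. 3.8 (p. 263)] -/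
def ParamPack.mono {S : Setup} {U U' : ℝ} (pk : S.ParamPack U) (hU : U ≤ U') : S.ParamPack U' where
  h := pk.h
  Lb := pk.Lb
  J₀ := pk.J₀
  L := pk.L
  Lθ := pk.Lθ
  S₀ := pk.S₀
  T := pk.T
  P := pk.P
  t := pk.t
  Dmax := pk.Dmax
  Mmax := pk.Mmax
  hS₀ := pk.hS₀
  ht := pk.ht
  htT := pk.htT
  hUp := pk.hUp.trans hU
  hsz := pk.hsz
  hfin hΛ := pk.hfin (hΛ.trans (Real.exp_le_exp.mpr (neg_le_neg hU)))
  hhalf hΛ := pk.hhalf (hΛ.trans (Real.exp_le_exp.mpr (neg_le_neg hU)))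
  hsiegel := pk.hsiegel
  hend := pk.hend

/-- From a pack at any exponent `U ≤ U'`: `‖Λ₀‖_p > e^{−U'}`. [cite: Waldschmidt1980, Prop. 3.8 (p. 263)] -/
theorem norm_Λ₀_gt_of_paramPack_le {S : Setup} {U U' : ℝ} (pk : S.ParamPack U) (hU : U ≤ U') :
    Real.exp (-U') < ‖S.Λ₀‖ :=
  S.norm_Λ₀_gt_of_paramPack (pk.mono hU)

end Setup

/-! ### From packs to the core bound and to Theorem A -/

/-- **Packs for every set-up give the core bound.** [cite: Waldschmidt1980, Prop. 3.8 (p. 263)] -/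
theorem coreBound_of_paramPack {C : ℕ → ℝ} {r : ℕ → ℕ}
    (hpk : ∀ (S : Setup) (V : Fin S.d → ℝ) (Vθ Vmax W : ℝ),
      (∀ T : Finset (Fin (S.d + 1)), T.Nonempty → ¬ IsSquare (∏ i ∈ T, S.all i)) →
      (∀ μ : Fin (S.d + 1) → ℤ, ∏ i, S.all i ^ μ i = 1 → μ = 0) →
      (∀ j, logHeight₁ (S.α j) ≤ V j) → logHeight₁ S.θ ≤ Vθ →
      (∀ j, Real.log S.p ≤ V j) → Real.log S.p ≤ Vθ → (∀ j, V j ≤ Vmax) → Vθ ≤ Vmax →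
      (∀ j, Real.log (max 3 (|S.b j| : ℝ)) ≤ W) → Real.log (max 3 (|S.bθ| : ℝ)) ≤ W →
      S.ParamPack (C (S.d + 1) * ((∏ j, V j) * Vθ) * (W + Real.log (2 * Vmax)) *
        Real.log (2 * Vmax) / Real.log S.p ^ r (S.d + 1))) :
    CoreBound C r :=
  fun S V Vθ Vmax W hK hμ hV hVθ hVp hVθp hVm hVθm hW hWθ =>
    S.norm_Λ₀_gt_of_paramPack (hpk S V Vθ Vmax W hK hμ hV hVθ hVp hVθp hVm hVθm hW hWθ)

/-- **Theorem A in the cell's shape** (verbatim `AbcStewartYuPlan.TheoremA` with `SymmBound` =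
`PadicCW77Bound`): some constant of W80 type `C m ≤ c₁^m m^{c₂ m}`, `c₂ ≤ 10`.
[cite: Waldschmidt1980, Prop. 3.8 (p. 263)] -/
def TheoremAShape : Prop :=
  ∃ (C : ℕ → ℝ) (r : ℕ → ℕ) (c₁ c₂ : ℝ), 1 ≤ c₁ ∧ 0 ≤ c₂ ∧ c₂ ≤ 10 ∧
    (∀ m, 0 ≤ C m ∧ C m ≤ c₁ ^ m * (m : ℝ) ^ (c₂ * m)) ∧ SymmBound C r

/-- **Theorem A with exponent cap `κ`**: the same shape with `c₂ ≤ κ` in place of `c₂ ≤ 10` (the cell's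
`TheoremATwo` is `κ = 2`). [cite: Waldschmidt1980, Prop. 3.8 (p. 263)] -/
def TheoremAShapeLe (κ : ℝ) : Prop :=
  ∃ (C : ℕ → ℝ) (r : ℕ → ℕ) (c₁ c₂ : ℝ), 1 ≤ c₁ ∧ 0 ≤ c₂ ∧ c₂ ≤ κ ∧
    (∀ m, 0 ≤ C m ∧ C m ≤ c₁ ^ m * (m : ℝ) ^ (c₂ * m)) ∧ SymmBound C r

/-- `TheoremAShape = TheoremAShapeLe 10`. [cite: Waldschmidt1980, Prop. 3.8 (p. 263)] -/
theorem theoremAShape_iff : TheoremAShape ↔ TheoremAShapeLe 10 := Iff.rfl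

/-- Monotonicity of the capped shape in the cap. [cite: Waldschmidt1980, Prop. 3.8 (p. 263)] -/
theorem TheoremAShapeLe.mono {κ κ' : ℝ} (h : TheoremAShapeLe κ) (hκ : κ ≤ κ') : TheoremAShapeLe κ' := by
  obtain ⟨C, r, c₁, c₂, h1, h2, h3, h4, h5⟩ := h
  exact ⟨C, r, c₁, c₂, h1, h2, h3.trans hκ, h4, h5⟩

/-- **The core bound with a W80-type constant gives Theorem A with cap `κ ≥ c₂`** (constant
`m ↦ 2 C m` for `m ≥ 1`, `1` at `m = 0`, where the symmetric statement is vacuous).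
[cite: Yu1990, Theorem 1] [cite: Waldschmidt1980, Prop. 3.8 (p. 263)] -/
theorem theoremAShapeLe_of_coreBound {C : ℕ → ℝ} {r : ℕ → ℕ} {c₁ c₂ κ : ℝ} (hc₁ : 1 ≤ c₁)
    (hc₂ : 0 ≤ c₂) (hc₂' : c₂ ≤ κ) (hC2 : ∀ m, 1 ≤ m → 2 ≤ C m)
    (henv : ∀ m, 1 ≤ m → 2 * C m ≤ c₁ ^ m * (m : ℝ) ^ (c₂ * m)) (hr : ∀ m, r m ≤ m)
    (hcore : CoreBound C r) : TheoremAShapeLe κ := by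
  classical
  have hsymm := symmBound_of_coreBound hC2 hr hcore
  refine ⟨fun m => if m = 0 then 1 else 2 * C m, r, c₁, c₂, hc₁, hc₂, hc₂', fun m => ?_, ?_⟩
  · by_cases hm : m = 0
    · subst hm; simp
    · simp only [if_neg hm]
      have h1 := Nat.one_le_iff_ne_zero.mpr hm
      exact ⟨by linarith [hC2 m h1], henv m h1⟩
  · intro p hp hp2 m α b V Vmax W hα hmult hK hV hVp hVmax hb hW
    by_cases hm : m = 0
    · subst hm
      exact absurd (Subsingleton.elim b 0) hb
    · simp only [if_neg hm]
      exact hsymm p hp hp2 m α b V Vmax W hα hmult hK hV hVp hVmax hb hW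

/-- **The core bound with a W80-type constant gives Theorem A** (constant `m ↦ 2 C m` for `m ≥ 1`,
`1` at `m = 0`, where the symmetric statement is vacuous). [cite: Yu1990, Theorem 1]
[cite: Waldschmidt1980, Prop. 3.8 (p. 263)] -/
theorem theoremA_of_coreBound {C : ℕ → ℝ} {r : ℕ → ℕ} {c₁ c₂ : ℝ} (hc₁ : 1 ≤ c₁) (hc₂ : 0 ≤ c₂)
    (hc₂' : c₂ ≤ 10) (hC2 : ∀ m, 1 ≤ m → 2 ≤ C m)
    (henv : ∀ m, 1 ≤ m → 2 * C m ≤ c₁ ^ m * (m : ℝ) ^ (c₂ * m)) (hr : ∀ m, r m ≤ m)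
    (hcore : CoreBound C r) : TheoremAShape := by
  obtain ⟨C', r', c₁', c₂', h1, h2, h3, h4, h5⟩ :=
    theoremAShapeLe_of_coreBound hc₁ hc₂ le_rfl hC2 henv hr hcore
  exact ⟨C', r', c₁', c₂', h1, h2, h3.trans hc₂', h4, h5⟩


/-! ### The numerical inequality of the inner steps in logarithmic form (the WP-A4 target) -/

/-- `(√p)^n = exp((n/2) log p)`. [cite: Waldschmidt1980, §3.3 (p. 268)] -/
theorem sqrt_pow_eq_exp (S : Setup) (n : ℕ) :
    Real.sqrt S.p ^ n = Real.exp ((n : ℝ) / 2 * Real.log S.p) := by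
  have hp0 : (0 : ℝ) < S.p := by exact_mod_cast S.hp.pos
  rw [Real.sqrt_eq_rpow, ← Real.rpow_natCast, ← Real.rpow_mul hp0.le,
    Real.rpow_def_of_pos hp0]
  congr 1; ring

/-- `p^n = exp(n log p)`. [cite: Waldschmidt1980, §3.3 (p. 268)] -/
theorem natPow_eq_exp (S : Setup) (n : ℕ) : (S.p : ℝ) ^ n = Real.exp ((n : ℝ) * Real.log S.p) := by
  have hp0 : (0 : ℝ) < S.p := by exact_mod_cast S.hp.pos
  rw [← Real.rpow_natCast, Real.rpow_def_of_pos hp0]; congr 1; ring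

/-- **`KFinal` from two inequalities between logarithms** (the form in which WP-A4 verifies it from
the parameter record): with `kpts = 2^{k+J} S₀ / 2`, if `‖Λ₀‖_p ≤ e^{−U}` and for every `k < d`
(1) `(⌊hLb/(p−1)⌋ + ⌊(t−1)/(p−1)⌋ + condExp)·log p + log(Dmax·Mmax) < U` and
(2) `hLb·log p + log(Dmax·Mmax) < (kpts·t/2) log p`, then `KFinal J S₀ t Dmax Mmax`.
[cite: Waldschmidt1980, Lemma 3.6 (p. 272)] -/
theorem Setup.kFinal_of_log_ineq (S : Setup) {h Lb : ℕ} {U : ℝ} (J S₀ t : ℕ) (Dmax Mmax : ℕ → ℝ)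
    (hΛ : ‖S.Λ₀‖ ≤ Real.exp (-U)) (hDM : ∀ k, k < S.d → 0 < Dmax k ∧ 0 < Mmax k)
    (h1 : ∀ k, k < S.d →
      ((h * Lb / (S.p - 1) + (t - 1) / (S.p - 1) + condExp S.p (2 ^ (k + J) * S₀ / 2) t : ℕ) : ℝ) *
          Real.log S.p + Real.log (Dmax k * Mmax k) < U)
    (h2 : ∀ k, k < S.d →
      ((h * Lb : ℕ) : ℝ) * Real.log S.p + Real.log (Dmax k * Mmax k) <
        (((2 ^ (k + J) * S₀ / 2) * t : ℕ) : ℝ) / 2 * Real.log S.p) :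
    S.KFinal (h := h) (Lb := Lb) J S₀ t Dmax Mmax := by
  intro k hk
  obtain ⟨hD, hM⟩ := hDM k hk
  have hDM0 : 0 < Dmax k * Mmax k := mul_pos hD hM
  have hinv : 1 / (Dmax k * Mmax k) = Real.exp (-Real.log (Dmax k * Mmax k)) := by
    rw [Real.exp_neg, Real.exp_log hDM0, one_div]
  rw [hinv]
  refine max_lt ?_ ?_
  · -- the smallness branch
    rcases (norm_nonneg S.Λ₀).eq_or_lt with h0 | hpos
    · rw [← h0]; simp [Real.exp_pos]
    · have e1 : (S.p : ℝ) ^ (h * Lb / (S.p - 1)) * ‖S.Λ₀‖ * (S.p : ℝ) ^ ((t - 1) / (S.p - 1)) *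
          (S.p : ℝ) ^ condExp S.p (2 ^ (k + J) * S₀ / 2) t =
          Real.exp (((h * Lb / (S.p - 1) : ℕ) : ℝ) * Real.log S.p + Real.log ‖S.Λ₀‖ +
            (((t - 1) / (S.p - 1) : ℕ) : ℝ) * Real.log S.p +
            (condExp S.p (2 ^ (k + J) * S₀ / 2) t : ℝ) * Real.log S.p) := by
        rw [natPow_eq_exp, natPow_eq_exp, natPow_eq_exp, ← Real.exp_log hpos]
        simp only [← Real.exp_add, Real.log_exp]
      rw [e1, Real.exp_lt_exp]
      have hlog : Real.log ‖S.Λ₀‖ ≤ -U := by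
        have := Real.log_le_log hpos hΛ; rwa [Real.log_exp] at this
      have h1k := h1 k hk
      push_cast at h1k ⊢
      linarith
  · -- the Schwarz branch
    have e2 : (S.p : ℝ) ^ (h * Lb) / Real.sqrt S.p ^ ((2 ^ (k + J) * S₀ / 2) * t) =
        Real.exp (((h * Lb : ℕ) : ℝ) * Real.log S.p -
          (((2 ^ (k + J) * S₀ / 2) * t : ℕ) : ℝ) / 2 * Real.log S.p) := by
      rw [natPow_eq_exp, sqrt_pow_eq_exp, ← Real.exp_sub]
    rw [e2, Real.exp_lt_exp]
    have h2k := h2 k hk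
    linarith


/-! ### `p`-free forms of the two inequalities (the targets WP-A4 actually verifies)

`log p/(p−1) ≤ log 3/2` for `p ≥ 3`, and `condExp · log p ≤ kpts·t·log p/(p−1) + t·log(2 kpts)`;
hence (1) follows from the `p`-FREE inequality
(1°) `(log 3/2)·(hLb + (t−1) + kpts·t) + t·log(2 kpts) + log(Dmax·Mmax) < U`,
and (2) from its `p = 3` instance (2°) `hLb·log 3 + log(Dmax·Mmax) < (kpts·t/2)·log 3` when
`log(Dmax·Mmax) ≥ 0`. -/

/-- `log p / (p − 1) ≤ log 3 / 2` for `p ≥ 3` (`log p ≤ log 3 + (p − 3)/3` and `2/3 ≤ log 3`).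
[cite: Waldschmidt1980, §3.3 (p. 268)] -/
theorem log_div_sub_one_le {p : ℕ} (hp : 3 ≤ p) :
    Real.log p / ((p : ℝ) - 1) ≤ Real.log 3 / 2 := by
  have hp3 : (3 : ℝ) ≤ p := by exact_mod_cast hp
  have hl3 : 1 < Real.log 3 := by
    have h := Real.exp_one_lt_d9
    rw [Real.lt_log_iff_exp_lt (by norm_num)]
    linarith
  have h1 : Real.log p ≤ Real.log 3 + ((p : ℝ) / 3 - 1) := by
    have e : Real.log p = Real.log 3 + Real.log ((p : ℝ) / 3) := by
      rw [← Real.log_mul (by norm_num) (by positivity)]; congr 1; ring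
    rw [e]
    have := Real.log_le_sub_one_of_pos (show (0 : ℝ) < p / 3 by positivity)
    linarith
  rw [div_le_div_iff₀ (by linarith) two_pos]
  nlinarith

/-- `⌊a/(p−1)⌋ · log p ≤ a · (log 3/2)` for `p ≥ 3`. [cite: Waldschmidt1980, §3.3 (p. 268)] -/
theorem natDiv_mul_log_le {p : ℕ} (hp : 3 ≤ p) (a : ℕ) :
    ((a / (p - 1) : ℕ) : ℝ) * Real.log p ≤ (a : ℝ) * (Real.log 3 / 2) := by
  have hp1 : (0 : ℝ) < (p : ℝ) - 1 := by
    have : (3 : ℝ) ≤ p := by exact_mod_cast hp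
    linarith
  have hlp : 0 ≤ Real.log p := Real.log_natCast_nonneg p
  have h1 : ((a / (p - 1) : ℕ) : ℝ) ≤ (a : ℝ) / ((p : ℝ) - 1) := by
    have e : (((p - 1 : ℕ) : ℕ) : ℝ) = (p : ℝ) - 1 := by
      have : 1 ≤ p := by omega
      push_cast [Nat.cast_sub this]; ring
    rw [← e]; exact Nat.cast_div_le
  calc ((a / (p - 1) : ℕ) : ℝ) * Real.log p ≤ (a : ℝ) / ((p : ℝ) - 1) * Real.log p :=
        mul_le_mul_of_nonneg_right h1 hlp
    _ = (a : ℝ) * (Real.log p / ((p : ℝ) - 1)) := by ring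
    _ ≤ (a : ℝ) * (Real.log 3 / 2) := mul_le_mul_of_nonneg_left (log_div_sub_one_le hp) (Nat.cast_nonneg _)

/-- **`condExp · log p ≤ kpts·t·log p/(p−1) + t·log(2 kpts)`**: the `j`-th level costs
`t(⌊kpts/p^{j+1}⌋ + 1)`, the geometric series gives `kpts·t/(p−1)`, and there are
`⌊log_p(2 kpts)⌋ ≤ log(2 kpts)/log p` levels. [cite: Yu1990, §3] -/
theorem condExp_mul_log_le {p : ℕ} (hp : 2 ≤ p) (kpts t : ℕ) :
    (condExp p kpts t : ℝ) * Real.log p ≤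
      (kpts : ℝ) * t * (Real.log p / ((p : ℝ) - 1)) + t * Real.log (2 * kpts) := by
  have hp0 : (0 : ℝ) < p := by exact_mod_cast (show 0 < p by omega)
  have hp1 : (1 : ℝ) < p := by exact_mod_cast (show 1 < p by omega)
  have hlp : 0 ≤ Real.log p := Real.log_nonneg hp1.le
  set Jm := Nat.log p (2 * kpts) with hJm
  -- the sum of the integer parts: `∑_{j<Jm} ⌊kpts/p^{j+1}⌋ ≤ kpts/(p-1)`
  have hgeom : ((∑ j ∈ range Jm, kpts / p ^ (j + 1) : ℕ) : ℝ) ≤ (kpts : ℝ) / ((p : ℝ) - 1) := by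
    push_cast
    have h1 : ∀ j ∈ range Jm, ((kpts / p ^ (j + 1) : ℕ) : ℝ) ≤ (kpts : ℝ) * ((p : ℝ)⁻¹) ^ (j + 1) := by
      intro j _
      refine (Nat.cast_div_le).trans (le_of_eq ?_)
      rw [Nat.cast_pow, div_eq_mul_inv, inv_pow]
    refine (sum_le_sum h1).trans ?_
    have hr0 : (0 : ℝ) ≤ (p : ℝ)⁻¹ := by positivity
    have hr1 : (p : ℝ)⁻¹ < 1 := inv_lt_one_of_one_lt₀ hp1
    have h2 : ∑ j ∈ range Jm, (kpts : ℝ) * ((p : ℝ)⁻¹) ^ (j + 1) =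
        (kpts : ℝ) * (p : ℝ)⁻¹ * ∑ j ∈ range Jm, ((p : ℝ)⁻¹) ^ j := by
      rw [mul_sum]; refine sum_congr rfl fun j _ => ?_; rw [pow_succ]; ring
    rw [h2]
    have h3 : ∑ j ∈ range Jm, ((p : ℝ)⁻¹) ^ j ≤ (1 - (p : ℝ)⁻¹)⁻¹ := by
      have := geom_sum_Ico_le_of_lt_one (m := 0) (n := Jm) hr0 hr1
      rwa [← Finset.range_eq_Ico, pow_zero, one_div] at this
    calc (kpts : ℝ) * (p : ℝ)⁻¹ * ∑ j ∈ range Jm, ((p : ℝ)⁻¹) ^ j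
        ≤ (kpts : ℝ) * (p : ℝ)⁻¹ * (1 - (p : ℝ)⁻¹)⁻¹ :=
          mul_le_mul_of_nonneg_left h3 (by positivity)
      _ = (kpts : ℝ) / ((p : ℝ) - 1) := by
          field_simp
  -- the number of levels: `Jm · log p ≤ log (2 kpts)`
  have hlev : (Jm : ℝ) * Real.log p ≤ Real.log (2 * kpts) := by
    rcases Nat.eq_zero_or_pos kpts with hk | hk
    · simp [hJm, hk]
    · have h1 : p ^ Jm ≤ 2 * kpts := Nat.pow_log_le_self p (by omega)
      have h2 : (p : ℝ) ^ Jm ≤ 2 * kpts := by exact_mod_cast h1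
      have := Real.log_le_log (by positivity) h2
      rwa [Real.log_pow] at this
  -- assemble
  have e : (condExp p kpts t : ℝ) =
      (t : ℝ) * ((∑ j ∈ range Jm, kpts / p ^ (j + 1) : ℕ) : ℝ) + t * Jm := by
    unfold condExp
    rw [← hJm]
    push_cast
    simp only [mul_add, mul_one, Finset.sum_add_distrib, Finset.sum_const, card_range, nsmul_eq_mul,
      Finset.mul_sum]
    ring
  rw [e, add_mul]
  have ht0 : (0 : ℝ) ≤ t := Nat.cast_nonneg _
  have hA : (t : ℝ) * ((∑ j ∈ range Jm, kpts / p ^ (j + 1) : ℕ) : ℝ) * Real.log p ≤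
      (kpts : ℝ) * t * (Real.log p / ((p : ℝ) - 1)) := by
    calc (t : ℝ) * ((∑ j ∈ range Jm, kpts / p ^ (j + 1) : ℕ) : ℝ) * Real.log p
        ≤ (t : ℝ) * ((kpts : ℝ) / ((p : ℝ) - 1)) * Real.log p := by gcongr
      _ = (kpts : ℝ) * t * (Real.log p / ((p : ℝ) - 1)) := by ring
  have hB : (t : ℝ) * Jm * Real.log p ≤ t * Real.log (2 * kpts) := by
    calc (t : ℝ) * Jm * Real.log p = t * ((Jm : ℝ) * Real.log p) := by ring
      _ ≤ t * Real.log (2 * kpts) := mul_le_mul_of_nonneg_left hlev ht0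
  linarith

/-- **(1) from the `p`-free inequality (1°)**: for `p ≥ 3`,
`(log 3/2)(hLb + (t−1) + kpts t) + t log(2 kpts) + DM < U` implies
`(⌊hLb/(p−1)⌋ + ⌊(t−1)/(p−1)⌋ + condExp p kpts t)·log p + DM < U`. [cite: Yu1990, §3] -/
theorem log_ineq_one_of_pfree {p : ℕ} (hp : 3 ≤ p) {hLb t kpts : ℕ} {DM U : ℝ}
    (h : Real.log 3 / 2 * ((hLb : ℝ) + ((t - 1 : ℕ) : ℝ) + (kpts : ℝ) * t) +
      t * Real.log (2 * kpts) + DM < U) :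
    ((hLb / (p - 1) + (t - 1) / (p - 1) + condExp p kpts t : ℕ) : ℝ) * Real.log p + DM < U := by
  have h1 := natDiv_mul_log_le hp hLb
  have h2 := natDiv_mul_log_le hp (t - 1)
  have h3 := condExp_mul_log_le (show 2 ≤ p by omega) kpts t
  have h4 := log_div_sub_one_le hp
  have hkt : (0 : ℝ) ≤ (kpts : ℝ) * t := by positivity
  have h5 : (kpts : ℝ) * t * (Real.log p / ((p : ℝ) - 1)) ≤ (kpts : ℝ) * t * (Real.log 3 / 2) :=
    mul_le_mul_of_nonneg_left h4 hkt
  push_cast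
  nlinarith

/-- **(2) from its `p = 3` instance (2°)**: for `p ≥ 3` and `DM ≥ 0`,
`hLb·log 3 + DM < (kpts·t/2)·log 3` implies `hLb·log p + DM < (kpts·t/2)·log p`.
[cite: Waldschmidt1980, Lemma 3.6 (p. 272)] -/
theorem log_ineq_two_of_pfree {p : ℕ} (hp : 3 ≤ p) {hLb kt : ℕ} {DM : ℝ} (hDM : 0 ≤ DM)
    (h : (hLb : ℝ) * Real.log 3 + DM < (kt : ℝ) / 2 * Real.log 3) :
    (hLb : ℝ) * Real.log p + DM < (kt : ℝ) / 2 * Real.log p := by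
  have hl3 : 0 < Real.log 3 := Real.log_pos (by norm_num)
  have hlp : Real.log 3 ≤ Real.log p := Real.log_le_log (by norm_num) (by exact_mod_cast hp)
  have hcoef : 0 < (kt : ℝ) / 2 - hLb := by nlinarith
  nlinarith

/-- **`KFinal` from the `p`-free inequalities** (the WP-A4 targets): with `kpts = 2^{k+J} S₀/2`,
`‖Λ₀‖_p ≤ e^{−U}`, `Dmax, Mmax > 0` with `Dmax·Mmax ≥ 1`, and for every `k < d`
(1°) `(log 3/2)·(hLb + (t−1) + kpts·t) + t·log(2 kpts) + log(Dmax·Mmax) < U`,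
(2°) `hLb·log 3 + log(Dmax·Mmax) < (kpts·t/2)·log 3`. [cite: Waldschmidt1980, Lemma 3.6 (p. 272)]
[cite: Yu1990, §3] -/
theorem Setup.kFinal_of_pfree_ineq (S : Setup) {h Lb : ℕ} {U : ℝ} (J S₀ t : ℕ) (Dmax Mmax : ℕ → ℝ)
    (hΛ : ‖S.Λ₀‖ ≤ Real.exp (-U)) (hDM : ∀ k, k < S.d → 0 < Dmax k ∧ 0 < Mmax k)
    (hDM1 : ∀ k, k < S.d → 1 ≤ Dmax k * Mmax k)
    (h1 : ∀ k, k < S.d →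
      Real.log 3 / 2 * (((h * Lb : ℕ) : ℝ) + ((t - 1 : ℕ) : ℝ) + ((2 ^ (k + J) * S₀ / 2 : ℕ) : ℝ) * t) +
        t * Real.log (2 * ((2 ^ (k + J) * S₀ / 2 : ℕ) : ℝ)) + Real.log (Dmax k * Mmax k) < U)
    (h2 : ∀ k, k < S.d →
      ((h * Lb : ℕ) : ℝ) * Real.log 3 + Real.log (Dmax k * Mmax k) <
        (((2 ^ (k + J) * S₀ / 2) * t : ℕ) : ℝ) / 2 * Real.log 3) :
    S.KFinal (h := h) (Lb := Lb) J S₀ t Dmax Mmax := by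
  refine S.kFinal_of_log_ineq J S₀ t Dmax Mmax hΛ hDM (fun k hk => ?_) (fun k hk => ?_)
  · exact log_ineq_one_of_pfree S.hp3 (h1 k hk)
  · exact log_ineq_two_of_pfree S.hp3 (Real.log_nonneg (hDM1 k hk)) (h2 k hk)

/-! ### The case `d = 0` (one logarithm): Liouville alone -/

/-- For `d = 0`, `Λ₀ = −log_p θ`, so `‖Λ₀‖_p = ‖θ − 1‖_p`. [cite: Yu1990, §1.1] -/
theorem Setup.norm_Λ₀_eq_of_d_zero (S : Setup) (hd : S.d = 0) :
    ‖S.Λ₀‖ = ‖1 - (S.θ : ℚ_[S.p])‖ := by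
  have h0 : ∑ j : Fin S.d, (S.frame.β j : ℚ_[S.p]) * S.lg j = 0 := by
    have : IsEmpty (Fin S.d) := by rw [hd]; infer_instance
    exact Finset.sum_eq_zero fun j _ => (IsEmpty.false j).elim
  unfold Setup.Λ₀
  rw [h0, zero_sub, norm_neg]
  exact PadicExp.norm_plog S.hp3 S.norm_one_sub_θ_le

/-- **Liouville for `θ − 1`**: `‖θ − 1‖_p ≥ 1/(2 H(θ))` (`H = max(|num|, den)`): `θ − 1 = (num θ − den θ)/den θ`
and an integer `m ≠ 0` has `‖m‖_p ≥ 1/|m|`. [cite: Yu1990, Lemma 2.5] -/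
theorem Setup.norm_one_sub_θ_ge (S : Setup) :
    1 / (2 * CW77.hgt S.θ) ≤ ‖1 - (S.θ : ℚ_[S.p])‖ := by
  have hθ1 : S.θ ≠ 1 := S.ne_one_of_one_le_padicValRat S.hθ
  set m : ℤ := S.θ.num - S.θ.den with hm
  have hm0 : m ≠ 0 := by
    intro h0
    apply hθ1
    have hnd : (S.θ.num : ℚ) = S.θ.den := by
      have : (S.θ.num : ℤ) = S.θ.den := by omega
      exact_mod_cast this
    have := Rat.num_div_den S.θ
    rw [hnd, div_self (by exact_mod_cast S.θ.pos.ne')] at this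
    exact this.symm
  have hden0 : (S.θ.den : ℚ_[S.p]) ≠ 0 := by exact_mod_cast S.θ.pos.ne'
  -- `1 − θ = −m/den`
  have e : (1 : ℚ_[S.p]) - (S.θ : ℚ_[S.p]) = -((m : ℚ_[S.p]) / (S.θ.den : ℚ_[S.p])) := by
    have hq : (S.θ : ℚ_[S.p]) = (S.θ.num : ℚ_[S.p]) / (S.θ.den : ℚ_[S.p]) := by
      rw [← Rat.cast_intCast, ← Rat.cast_natCast, ← Rat.cast_div, Rat.num_div_den]
    rw [hq, hm]; push_cast
    field_simp
    ring
  rw [e, norm_neg, norm_div]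
  have hden1 : ‖(S.θ.den : ℚ_[S.p])‖ ≤ 1 := by exact_mod_cast Padic.norm_int_le_one (p := S.p) (S.θ.den : ℤ)
  have hdenpos : 0 < ‖(S.θ.den : ℚ_[S.p])‖ := norm_pos_iff.mpr hden0
  have h1 : ‖(m : ℚ_[S.p])‖ ≤ ‖(m : ℚ_[S.p])‖ / ‖(S.θ.den : ℚ_[S.p])‖ := by
    rw [le_div_iff₀ hdenpos]; exact mul_le_of_le_one_right (norm_nonneg _) hden1
  refine le_trans ?_ h1
  refine le_trans ?_ (one_div_le_norm_intCast (p := S.p) hm0)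
  -- `|m| ≤ |num| + den ≤ 2 H(θ)`
  have hH : |(m : ℝ)| ≤ 2 * CW77.hgt S.θ := by
    have h2 : |(m : ℝ)| ≤ (S.θ.num.natAbs : ℝ) + S.θ.den := by
      rw [hm]; push_cast
      have : |(S.θ.num : ℝ)| = (S.θ.num.natAbs : ℝ) := by
        rw [Nat.cast_natAbs, Int.cast_abs]
      calc |(S.θ.num : ℝ) - S.θ.den| ≤ |(S.θ.num : ℝ)| + |(S.θ.den : ℝ)| := abs_sub _ _
        _ = (S.θ.num.natAbs : ℝ) + S.θ.den := by rw [this, Nat.abs_cast]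
    have h3 : (S.θ.num.natAbs : ℝ) ≤ CW77.hgt S.θ := by
      unfold CW77.hgt; exact_mod_cast le_max_left _ _
    linarith [CW77.den_le_hgt S.θ]
  have hmpos : 0 < |(m : ℝ)| := abs_pos.mpr (by exact_mod_cast hm0)
  exact one_div_le_one_div_of_le hmpos hH

/-- **The core bound for `d = 0`** (one logarithm `θ`): if `r 1 = 0` and `2 ≤ C 1`, the inequality of
`CoreBound` at a set-up with `d = 0` holds by Liouville alone (`U ≥ 2 V_θ (W + log 2V_max) log(2V_max)
> h(θ) + log 2 ≥ −log ‖θ − 1‖_p`). [cite: Yu1990, §1.1] -/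
theorem Setup.coreBound_of_d_zero (S : Setup) (hd : S.d = 0) {C : ℕ → ℝ} {r : ℕ → ℕ}
    (hr1 : r 1 = 0) (hC1 : 2 ≤ C 1) (V : Fin S.d → ℝ) (Vθ Vmax W : ℝ)
    (hVθ : logHeight₁ S.θ ≤ Vθ) (hVθp : Real.log S.p ≤ Vθ) (hVθm : Vθ ≤ Vmax)
    (hWθ : Real.log (max 3 (|S.bθ| : ℝ)) ≤ W) :
    Real.exp (-(C (S.d + 1) * ((∏ j, V j) * Vθ) * (W + Real.log (2 * Vmax)) *
      Real.log (2 * Vmax) / Real.log S.p ^ r (S.d + 1))) < ‖S.Λ₀‖ := by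
  have hV1 : ∏ j : Fin S.d, V j = 1 := by
    have : IsEmpty (Fin S.d) := by rw [hd]; infer_instance
    exact Finset.prod_eq_one fun j _ => (IsEmpty.false j).elim
  rw [hV1, one_mul, hd, zero_add, hr1, pow_zero, div_one, S.norm_Λ₀_eq_of_d_zero hd]
  -- numerics: `log 3 > 1`, `log 2 > 0.69`
  have hlog3 : 1 < Real.log 3 := by
    rw [Real.lt_log_iff_exp_lt (by norm_num)]
    have := Real.exp_one_lt_d9; linarith
  have hlog2 := Real.log_two_gt_d9
  have hlog2' := Real.log_two_lt_d9
  have hp3 : (3 : ℝ) ≤ S.p := by exact_mod_cast S.hp3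
  have hVθ1 : 1 < Vθ := lt_of_lt_of_le (lt_of_lt_of_le hlog3 (Real.log_le_log (by norm_num) hp3)) hVθp
  have hW3 : 1 < W := lt_of_lt_of_le (lt_of_lt_of_le hlog3 (Real.log_le_log (by norm_num) (le_max_left _ _))) hWθ
  have hl2V : Real.log 2 ≤ Real.log (2 * Vmax) := Real.log_le_log two_pos (by linarith)
  have hH : Real.log (CW77.hgt S.θ) = logHeight₁ S.θ := by rw [Rat.logHeight₁_eq_log_max]; rfl
  have hHpos : 0 < CW77.hgt S.θ := lt_of_lt_of_le one_pos (CW77.one_le_hgt _)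
  -- `exp(−U) < 1/(2 H(θ))`
  have hU : logHeight₁ S.θ + Real.log 2 < C 1 * Vθ * (W + Real.log (2 * Vmax)) * Real.log (2 * Vmax) := by
    have ha : 2 * Vθ ≤ C 1 * Vθ := mul_le_mul_of_nonneg_right hC1 (by linarith)
    have hb : (1 + 0.69 : ℝ) ≤ W + Real.log (2 * Vmax) := by linarith
    have hc : (0.69 : ℝ) ≤ Real.log (2 * Vmax) := by linarith
    have h0 : 0 ≤ C 1 * Vθ := le_trans (by linarith) ha
    have h1 : 2 * Vθ * (1 + 0.69) * 0.69 ≤ C 1 * Vθ * (W + Real.log (2 * Vmax)) * Real.log (2 * Vmax) :=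
      mul_le_mul (mul_le_mul ha hb (by norm_num) h0) hc (by norm_num)
        (mul_nonneg h0 (by linarith))
    linarith
  calc Real.exp (-(C 1 * Vθ * (W + Real.log (2 * Vmax)) * Real.log (2 * Vmax)))
      < Real.exp (-(logHeight₁ S.θ + Real.log 2)) := by rw [Real.exp_lt_exp]; linarith
    _ = 1 / (2 * CW77.hgt S.θ) := by
        rw [Real.exp_neg, ← hH, Real.exp_add, Real.exp_log hHpos, Real.exp_log two_pos, one_div, mul_comm]
    _ ≤ ‖1 - (S.θ : ℚ_[S.p])‖ := S.norm_one_sub_θ_ge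

/-- **Packs for every set-up with `d ≥ 1` give the core bound** (the case `d = 0` by Liouville,
for `r 1 = 0`, `2 ≤ C 1`). [cite: Waldschmidt1980, Prop. 3.8 (p. 263)] -/
theorem coreBound_of_paramPack_pos {C : ℕ → ℝ} {r : ℕ → ℕ} (hr1 : r 1 = 0) (hC1 : 2 ≤ C 1)
    (hpk : ∀ (S : Setup) (V : Fin S.d → ℝ) (Vθ Vmax W : ℝ), 1 ≤ S.d →
      (∀ T : Finset (Fin (S.d + 1)), T.Nonempty → ¬ IsSquare (∏ i ∈ T, S.all i)) →
      (∀ μ : Fin (S.d + 1) → ℤ, ∏ i, S.all i ^ μ i = 1 → μ = 0) →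
      (∀ j, logHeight₁ (S.α j) ≤ V j) → logHeight₁ S.θ ≤ Vθ →
      (∀ j, Real.log S.p ≤ V j) → Real.log S.p ≤ Vθ → (∀ j, V j ≤ Vmax) → Vθ ≤ Vmax →
      (∀ j, Real.log (max 3 (|S.b j| : ℝ)) ≤ W) → Real.log (max 3 (|S.bθ| : ℝ)) ≤ W →
      S.ParamPack (C (S.d + 1) * ((∏ j, V j) * Vθ) * (W + Real.log (2 * Vmax)) *
        Real.log (2 * Vmax) / Real.log S.p ^ r (S.d + 1))) :
    CoreBound C r := by
  intro S V Vθ Vmax W hK hμ hV hVθ hVp hVθp hVm hVθm hW hWθ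
  rcases Nat.eq_zero_or_pos S.d with hd | hd
  · exact S.coreBound_of_d_zero hd hr1 hC1 V Vθ Vmax W hVθ hVθp hVθm hWθ
  · exact S.norm_Λ₀_gt_of_paramPack (hpk S V Vθ Vmax W hd hK hμ hV hVθ hVp hVθp hVm hVθm hW hWθ)

/-- **The closing adapter.** Suppose that for every set-up with `d ≥ 1`, Kummer-free independent
generators, sizes `V, V_θ ≤ V_max` (`≥ log p`) and coefficient bound `W`, there is a parameter pack
at SOME exponent `U ≤ Cw(d+1) · (∏Vⱼ·V_θ) · (W + log 2V_max) · log(2V_max)`, where `2 ≤ Cw m` and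
`2 Cw m ≤ c₁^m m^{c₂ m}` for `m ≥ 1`, `1 ≤ c₁`, `0 ≤ c₂ ≤ κ`. Then Theorem A holds with cap `κ`
(and `r = 0`): this is `ParamPack.mono` + `coreBound_of_paramPack_pos` +
`theoremAShapeLe_of_coreBound`. [cite: Waldschmidt1980, Prop. 3.8 (p. 263)] [cite: Yu1990, Theorem 1] -/
theorem theoremAShapeLe_of_packs {Cw : ℕ → ℝ} {c₁ c₂ κ : ℝ} (hc₁ : 1 ≤ c₁) (hc₂ : 0 ≤ c₂)
    (hc₂' : c₂ ≤ κ) (hC2 : ∀ m, 1 ≤ m → 2 ≤ Cw m)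
    (henv : ∀ m, 1 ≤ m → 2 * Cw m ≤ c₁ ^ m * (m : ℝ) ^ (c₂ * m))
    (hpk : ∀ (S : Setup) (V : Fin S.d → ℝ) (Vθ Vmax W : ℝ), 1 ≤ S.d →
      (∀ T : Finset (Fin (S.d + 1)), T.Nonempty → ¬ IsSquare (∏ i ∈ T, S.all i)) →
      (∀ μ : Fin (S.d + 1) → ℤ, ∏ i, S.all i ^ μ i = 1 → μ = 0) →
      (∀ j, logHeight₁ (S.α j) ≤ V j) → logHeight₁ S.θ ≤ Vθ →
      (∀ j, Real.log S.p ≤ V j) → Real.log S.p ≤ Vθ → (∀ j, V j ≤ Vmax) → Vθ ≤ Vmax →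
      (∀ j, Real.log (max 3 (|S.b j| : ℝ)) ≤ W) → Real.log (max 3 (|S.bθ| : ℝ)) ≤ W →
      ∃ U : ℝ, U ≤ Cw (S.d + 1) * ((∏ j, V j) * Vθ) * (W + Real.log (2 * Vmax)) *
        Real.log (2 * Vmax) ∧ Nonempty (S.ParamPack U)) :
    TheoremAShapeLe κ := by
  refine theoremAShapeLe_of_coreBound (r := fun _ => 0) hc₁ hc₂ hc₂' hC2 henv
    (fun _ => Nat.zero_le _) ?_
  intro S V Vθ Vmax W hK hμ hV hVθ hVp hVθp hVm hVθm hW hWθ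
  rcases Nat.eq_zero_or_pos S.d with hd | hd
  · exact S.coreBound_of_d_zero hd (r := fun _ => 0) rfl (hC2 1 le_rfl) V Vθ Vmax W hVθ hVθp hVθm hWθ
  · obtain ⟨U, hU, ⟨pk⟩⟩ := hpk S V Vθ Vmax W hd hK hμ hV hVθ hVp hVθp hVm hVθm hW hWθ
    refine Setup.norm_Λ₀_gt_of_paramPack_le pk ?_
    rw [pow_zero, div_one]
    exact hU

/-- The closing adapter at the cell's cap `10`. [cite: Waldschmidt1980, Prop. 3.8 (p. 263)] -/
theorem theoremAShape_of_packs {Cw : ℕ → ℝ} {c₁ c₂ : ℝ} (hc₁ : 1 ≤ c₁) (hc₂ : 0 ≤ c₂)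
    (hc₂' : c₂ ≤ 10) (hC2 : ∀ m, 1 ≤ m → 2 ≤ Cw m)
    (henv : ∀ m, 1 ≤ m → 2 * Cw m ≤ c₁ ^ m * (m : ℝ) ^ (c₂ * m))
    (hpk : ∀ (S : Setup) (V : Fin S.d → ℝ) (Vθ Vmax W : ℝ), 1 ≤ S.d →
      (∀ T : Finset (Fin (S.d + 1)), T.Nonempty → ¬ IsSquare (∏ i ∈ T, S.all i)) →
      (∀ μ : Fin (S.d + 1) → ℤ, ∏ i, S.all i ^ μ i = 1 → μ = 0) →
      (∀ j, logHeight₁ (S.α j) ≤ V j) → logHeight₁ S.θ ≤ Vθ →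
      (∀ j, Real.log S.p ≤ V j) → Real.log S.p ≤ Vθ → (∀ j, V j ≤ Vmax) → Vθ ≤ Vmax →
      (∀ j, Real.log (max 3 (|S.b j| : ℝ)) ≤ W) → Real.log (max 3 (|S.bθ| : ℝ)) ≤ W →
      ∃ U : ℝ, U ≤ Cw (S.d + 1) * ((∏ j, V j) * Vθ) * (W + Real.log (2 * Vmax)) *
        Real.log (2 * Vmax) ∧ Nonempty (S.ParamPack U)) :
    TheoremAShape :=
  theoremAShapeLe_of_packs hc₁ hc₂ hc₂' hC2 henv hpk

end PadicCW77

end Literature.NumberTheory.Transcendental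

end
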